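import Literature.MathematicalPhysics.QuantumFieldTheory.Balaban1983to89.B9Eq3101ConjugationLetters

/-!
# `Balaban1983to89.B9Eq3102QprimeCommutatorLetters` — T. Bałaban, *Propagators for lattice gauge theories in a background field*, Commun. Math.
# Phys. **99** (1985) 389–434 [Balaban1985BackgroundPropagators] (3.102) p. 414 with (3.19) p. 393, (3.24) p. 394, (3.88) p. 409 and (3.11) p. 392:
# **THE SINGLE AND DOUBLE COMMUTATOR LETTERS OF THE SCALAR BLOCK AVERAGING `Q′(U)` (3.19) WITH A QUADRATIC PARTITION, AT FUNCTION LEVEL** —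
# print's `[Q, h] = S(∂h)` of (3.102) for the GAUGE-PARAMETER averaging `Q′` (the averaging member `a′Q′*Q′` of `Δ′_{a′}(U)` (3.24), whose Green's
# function `G′ = (Δ′_a)⁻¹` builds `R(U)` ∕ `P = 1 − R(U)` — rows L8∕L9 of the instance ledger `t4/ROUTES-NE9.md` v13.30–v13.33 — and the averaging
# ingredient of print's `K(h)` (3.88)∕(3.104) for `Δ′_a`): for a family of real multipliers `χ_j` on the fine torus and `χ′_j` on the coarse torus
# with the BLOCK OSCILLATION letter `Σ_j (χ′_j(y) − χ_j(x))² ≤ Θ` (`x ∈ B(y)`) and contour transports bounded by `M_A`: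
# `Σ_jΣ_y ‖χ′_j(y)Q′λ(y) − Q′(χ_jλ)(y)‖² ≤ M_A²Θ·L^{−d}Σ_x‖λ x‖²`, `Σ_y‖Σ_j ad_j(ad_jQ′)λ(y)‖² ≤ (M_AΘ)²·L^{−d}Σ_x‖λ x‖²`, `Σ_y‖Q′λ(y)‖² ≤
# M_A²·L^{−d}Σ_x‖λ x‖²` — VOLUME-FREE, no `η`, no count of the family.  The `Q′`-ANALOGUE of kernel 7's `T₃` letters; kernel 7's OWN `T₃` is the
# VECTOR averaging `√a·Q(U)` (3.15) on 1-forms ((3.26) p. 395; ne9-leaf-01 g82's `B9Eq3102LeibnizCommutatorAveraging`, W-1 journal l.50082) —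
# route R2′ STEP B8′ of the pub-balaban NE9 chain

statement-level skeleton of published theorems with citation tags; proofs where landed; nothing here is a claim about the Yang–Mills mass gap

CITATION HEADER (lean-in-tree rule).  Audit cell `pub-balaban`, sub-cell `t4`, BINDER row NE9; filed by NE9 formalisation-swarm leaf prover 05
(`b2b-balaban-t4-ne9-formalise-leaf-05`, gen 74) as the SEQUEL of this lineage's `B9Eq3101ConjugationLetters` (gen 72: the EXPONENTIATED letter
`‖e^{κχ′}Q′(e^{−κχ}λ) − Q′λ‖` of the same operator, S-P5(b) input (I4)); here the PLAIN first- and second-order commutators.  LOCATED READING of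
record (ne9-leaf-01 g82 W-1 l.50082, CONCURRED by this seat): kernel 7 `B9Eq387IMSAssembly` runs on 1-FORMS with `T_i ∈ {D_U, D_U†, √a·Q(U)}`
((3.26)), its `T₃` is the VECTOR averaging `B9Eq315QTorus.QtorusW` (ne9-leaf-01 g82's INTENT-1∕2∕3); the scalar `Q′ = B9Eq319QprimeTorus.QprimeLin`
of THIS file is the averaging of the gauge-parameter operator `Δ′_a` (3.24) (rows L8∕L9 via `G′`), so the letters below are the `Q′`-ANALOGUE of the
`T₃` row — consumable by an IMS localisation of `Δ′_{a′}(U)` should the route book one (t4-ne9-idea-1 to rule on row L5's operator) and by print's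
`K(h)` commutator algebra (3.88)∕(3.102)–(3.104) for `Δ′_a` (route R2′ B8′ S-P6′ «the commutators ARE print's K(h) (3.88)», ROUTES-NE9 v13.22 (i)).
The hypothesis dress (a family `χ_j` with a quadratic increment letter; multipliers HYPOTHESISED to act pointwise on the weighted carriers —
t4-ne9-idea-1 g95's (J-P-γ), ne9-leaf-06 g66's `B9Eq311PointwiseMultipliers`, ne9-leaf-04 g76's `B9Eq3100LeibnizCommutator*`) is the cell's.  Source
READ in the held text (`paper:balaban1985-cmp99-background-propagators`, journal page = PDF page + 388): p. 414 (3.102) *«(Q_j hA)(c) =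
h(c₋)(Q_jA)(c) + Σ_b L^{−jd} Q_j(c, b)(∂h)(Γ_{c₋,b₋})A(b) = h(c₋)(Q_jA)(c) + (S_j(∂h)A)(c)»*, (3.103)–(3.104) *«K(h) is a sum of a first order
differential operator and the last two terms on the right-hand side of (3.103)»*, l.1–3 *«of the order O(M⁻¹), or O(M⁻²), if considered on a proper
scale»*; p. 409 (3.88) *«(Δ′_a h_□λ)(x) = h(x)(Δ′_aλ)(x) − (K(h)λ)(x)»*; (3.19) p. 393 (the averaging `Q′` with contour transports `R(U(Γ_{y,x}))`);
(3.24) p. 394 *«Δ′_a(U) = Δ^η_U + Q′*(U)aQ′(U)»*; (3.11) p. 392 (the weighted pairings).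

WHY.  (3.102) is print's statement that the commutator of an averaging operator with a slowly varying `h` is the average of the INCREMENT of `h`
times the contour transport («O(M⁻¹) on a proper scale»; squared increments for the double commutator, «O(M⁻²)»).  For the scalar `Q′` of (3.19) the
same algebra holds verbatim, and Cauchy–Schwarz on the block (`|B(y)| = L^d`, weight `L^{−d}`) prices a whole FAMILY of cut-offs by ONE letter
`Θ ≥ Σ_j (χ′_j(y) − χ_j(x))²` — no count of the family, no `η` (a block has bounded physical diameter at the point `ηL = 1`), the background only
through the transport letter `M_A`.  These are the shapes an IMS localisation of `Δ′_{a′}(U) = D_U*D_U + a′Q′*Q′` consumes for its averaging member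
(first-order square, double commutator, size — kernel 7's `a`, `k`, `t` alphabet), and the typed form of the averaging part of print's `K(h)`.

WHAT IS PROVED (sorry-free; proof lane — no `def`, no `Prop` placeholder; [folklore] finite sums and Cauchy–Schwarz; nothing of [B9] asserted).
* §1 (3.102) AT FUNCTION LEVEL for the tree's `QprimeLin L m Rb` and ANY real symbols `χ′` (coarse), `χ` (fine): **`comm_QprimeLin_apply`**
  (`χ′(y)·Q′λ(y) − Q′(χλ)(y) = Σ_{x∈B(y)} L^{−d}·(χ′(y) − χ(x))·R(Γ_{y,x})λ(x)` — print's `S(∂h)` for `Q′`), **`comm_comm_QprimeLin_apply`** (the double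
  commutator `= Σ_{x∈B(y)} L^{−d}·(χ′(y) − χ(x))²·R(Γ_{y,x})λ(x)`), `sum_comm_comm_QprimeLin_apply` (summed over a family: the weight `Σ_j (χ′_j(y) − χ_j(x))²`).
* §2 POINTWISE SIZES (transports `‖R(Γ_{y,x})v‖ ≤ M_A‖v‖`, block oscillation `Σ_{j∈s} (χ′_j(y) − χ_j(x))² ≤ Θ` on `x ∈ B(y)`):
  `norm_QprimeLin_apply_le` (`‖Q′λ(y)‖ ≤ M_A·L^{−d}Σ_{B(y)}‖λ x‖`), `norm_comm_QprimeLin_apply_le`, **`sum_norm_sq_comm_QprimeLin_apply_le`**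
  (`Σ_j ‖ad_jQ′λ(y)‖² ≤ M_A²Θ·L^{−d}Σ_{B(y)}‖λ x‖²`), **`norm_sum_comm_comm_QprimeLin_apply_le`** (`‖Σ_j ad_jad_jQ′λ(y)‖ ≤ M_AΘ·L^{−d}Σ_{B(y)}‖λ x‖`).
* §3 `ℓ²` SIZES over the coarse torus (Jensen on each block, the blocks partition the fine torus — this lineage's `blockMean_norm_sq_le`, `sum_blockOf_sum`):
  `sum_norm_sq_QprimeLin_le` (size: `Σ_y‖Q′λ(y)‖² ≤ M_A²·L^{−d}Σ_x‖λ x‖²`), **`sum_sum_norm_sq_comm_QprimeLin_le`** (first-order square: `Σ_jΣ_y‖ad_jQ′λ(y)‖² ≤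
  M_A²Θ·L^{−d}Σ_x‖λ x‖²`), **`sum_norm_sq_sum_comm_comm_QprimeLin_le`** (double commutator: `Σ_y‖Σ_j ad_jad_jQ′λ(y)‖² ≤ (M_AΘ)²·L^{−d}Σ_x‖λ x‖²`).
* THE SEQUEL `B9Eq3102QprimeCommutatorLettersCarrier` reads §3 on the chain's WEIGHTED carriers (`SiteL2K ℂ d (L·m) c₀ W` → the `c₁`-carrier over
  the coarse torus) for maps HYPOTHESISED to act as `Q′` and as the multipliers, in ne9-leaf-01's `hAD` ∕ `hTK` shapes, with the (dn) row of the IMS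
  identities for the scalar `Q̃′` at the diagonal `c₁ = L^d·c₀`.
HONEST SCOPE.  Identities and finite-sum inequalities at FUNCTION level only; NOT kernel 7's `T₃` (the vector `Q(U)` on 1-forms — ne9-leaf-01 g82);
the block-oscillation letter `Θ` (from a BOND letter `Σ_j(χ_j(b₋) − χ_j(b₊))² ≤ Θ₂` along the block contours: `Θ ≤ (d(L−1))²Θ₂`, sequel) and the
transport letter `M_A` are DISPLAYED (at the chain's `adTransportW φ U` with `U(b) ∈ U1`: `M_A = M_φM_φ′` by this lineage's
`B9Eq319ContourAxialGauge.hA_letter_AdW`); letters of ONE operator of one route step, NOT NE9 (cell pub-balaban: NE9 NOT PRINTED ∕ NOT PROVED; «NE9 ⇐ the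
named binders»; spine PROVED 0∕9; rung (B)+1 on a finite T⁴ — NOT infinite volume, NOT mass gap, NOT Clay; HONEST DEPENDENCY: continuum YM on T⁴ ⇐
BetaPertH ∧ nine spine estimates (0/9 proved); BetaPertH ⇐ (D1) ∧ (D4) ∧ CAP+tail; G-an2-4 gates asym, D1 and NE2/3/4).  NEW file importing this lineage's
`B9Eq3101ConjugationLetters` only; nothing modified.  Net new unproved facts: 0.
-/

noncomputable section

open scoped InnerProductSpace
open Finset

namespace Literature.MathematicalPhysics.QuantumFieldTheory.Balaban1983to89.B9Eq3102QprimeCommutatorLetters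

open B4Sect5Torus (TSite)
open B9SectCLatticeCarrier (Bond)
open B9Eq323Ker (pathTr)
open B9Eq319QprimeTorus (fineP centre contour stepTransport QprimeLin)
open B9Eq319QprimeLipschitz (blockMean_norm_sq_le sum_blockOf_sum)
open B9Eq3101ConjugationLetters (QprimeLin_apply_eq_sum pathTr_stepTransport_smul)
open B5Eq172FlatCoercivity (card_blockOf)

/-! ## §1 (3.102) for the one-step `Q′` of (3.19): the commutator with a multiplier is the block average of the increment -/

section Function

variable {d : ℕ} (L : ℕ) [NeZero L] (m : Fin d → ℕ) {V : Type*} [NormedAddCommGroup V] [NormedSpace ℂ V]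
  (Rb : Bond d (fineP L m) → V →ₗ[ℂ] V)

/-- **(3.102) FOR THE ONE-STEP `Q′` OF (3.19) — THE SINGLE COMMUTATOR IS THE BLOCK AVERAGE OF THE INCREMENT**: for real symbols `χ′` on the coarse
torus and `χ` on the fine torus, `χ′(y)·(Q′λ)(y) − Q′(χ·λ)(y) = Σ_{x∈B(y)} L^{−d}·(χ′(y) − χ(x))·R(U(Γ_{y,x}))λ(x)` — print's `S_j(∂h)` with the
cutoff sampled at one site per cell. [cite: Balaban1985BackgroundPropagators, (3.102) p.414, (3.19) p.393] -/
theorem comm_QprimeLin_apply (χ' : TSite d m → ℝ) (χ : TSite d (fineP L m) → ℝ) (l : TSite d (fineP L m) → V) (y : TSite d m) :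
    (χ' y : ℂ) • QprimeLin L m Rb l y - QprimeLin L m Rb (fun x => (χ x : ℂ) • l x) y =
      ∑ x ∈ B9Eq319QprimeTorus.blockOf L m y, ((L : ℝ) ^ d)⁻¹ •
        (((χ' y - χ x : ℝ) : ℂ) • pathTr (stepTransport L m fun b => (Rb b).restrictScalars ℝ) (centre L m y :: contour L m x) (l x)) := by
  rw [QprimeLin_apply_eq_sum, QprimeLin_apply_eq_sum, smul_sum, ← sum_sub_distrib]
  refine sum_congr rfl fun x _ => ?_
  rw [pathTr_stepTransport_smul, smul_comm (χ' y : ℂ), ← smul_sub, ← sub_smul, Complex.ofReal_sub]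

/-- **THE DOUBLE COMMUTATOR IS THE BLOCK AVERAGE OF THE SQUARED INCREMENT**: with `ad T := χ′·T − T∘χ`,
`χ′(y)·(ad Q′)λ(y) − (ad Q′)(χλ)(y) = Σ_{x∈B(y)} L^{−d}·(χ′(y) − χ(x))²·R(U(Γ_{y,x}))λ(x)` (p. 414 «O(M⁻²) … on a proper scale»).
[cite: Balaban1985BackgroundPropagators, (3.102) p.414, (3.19) p.393] -/
theorem comm_comm_QprimeLin_apply (χ' : TSite d m → ℝ) (χ : TSite d (fineP L m) → ℝ) (l : TSite d (fineP L m) → V) (y : TSite d m) :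
    (χ' y : ℂ) • ((χ' y : ℂ) • QprimeLin L m Rb l y - QprimeLin L m Rb (fun x => (χ x : ℂ) • l x) y) -
        ((χ' y : ℂ) • QprimeLin L m Rb (fun x => (χ x : ℂ) • l x) y - QprimeLin L m Rb (fun x => (χ x : ℂ) • ((χ x : ℂ) • l x)) y) =
      ∑ x ∈ B9Eq319QprimeTorus.blockOf L m y, ((L : ℝ) ^ d)⁻¹ •
        ((((χ' y - χ x) ^ 2 : ℝ) : ℂ) • pathTr (stepTransport L m fun b => (Rb b).restrictScalars ℝ) (centre L m y :: contour L m x) (l x)) := by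
  rw [comm_QprimeLin_apply, comm_QprimeLin_apply, smul_sum, ← sum_sub_distrib]
  refine sum_congr rfl fun x _ => ?_
  rw [pathTr_stepTransport_smul, smul_comm (χ' y : ℂ) (((L : ℝ) ^ d)⁻¹), ← smul_sub, smul_smul, smul_smul, ← sub_smul]
  congr 2
  push_cast
  ring

/-- **… SUMMED OVER A FAMILY**: `Σ_j [χ′_j(y)·(ad_jQ′)λ(y) − (ad_jQ′)(χ_jλ)(y)] = Σ_{x∈B(y)} L^{−d}·(Σ_j (χ′_j(y) − χ_j(x))²)·R(U(Γ_{y,x}))λ(x)` — the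
whole family enters through ONE weight. [cite: Balaban1985BackgroundPropagators, (3.102) p.414, p.408] -/
theorem sum_comm_comm_QprimeLin_apply {J : Type*} (s : Finset J) (χ' : J → TSite d m → ℝ) (χ : J → TSite d (fineP L m) → ℝ)
    (l : TSite d (fineP L m) → V) (y : TSite d m) :
    ∑ j ∈ s, ((χ' j y : ℂ) • ((χ' j y : ℂ) • QprimeLin L m Rb l y - QprimeLin L m Rb (fun x => (χ j x : ℂ) • l x) y) -
        ((χ' j y : ℂ) • QprimeLin L m Rb (fun x => (χ j x : ℂ) • l x) y - QprimeLin L m Rb (fun x => (χ j x : ℂ) • ((χ j x : ℂ) • l x)) y)) =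
      ∑ x ∈ B9Eq319QprimeTorus.blockOf L m y, ((L : ℝ) ^ d)⁻¹ •
        (((∑ j ∈ s, (χ' j y - χ j x) ^ 2 : ℝ) : ℂ) • pathTr (stepTransport L m fun b => (Rb b).restrictScalars ℝ) (centre L m y :: contour L m x) (l x)) := by
  simp only [comm_comm_QprimeLin_apply]
  rw [sum_comm]
  refine sum_congr rfl fun x _ => ?_
  rw [← smul_sum, ← sum_smul, Complex.ofReal_sum]

/-! ## §2 Pointwise sizes: Cauchy–Schwarz on the block -/

variable {Rb} {MA : ℝ}
  (hA : ∀ (y : TSite d m), ∀ x ∈ B9Eq319QprimeTorus.blockOf L m y, ∀ v : V,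
    ‖pathTr (stepTransport L m fun b => (Rb b).restrictScalars ℝ) (centre L m y :: contour L m x) v‖ ≤ MA * ‖v‖)

include hA in
/-- **THE SIZE OF `Q′`, POINTWISE** (kernel 7's letter `t`, here for the scalar `Q′`): `‖(Q′λ)(y)‖ ≤ M_A·L^{−d}·Σ_{x∈B(y)} ‖λ(x)‖` for contour transports bounded by `M_A`.
[cite: Balaban1985BackgroundPropagators, (3.19) p.393] -/
theorem norm_QprimeLin_apply_le (l : TSite d (fineP L m) → V) (y : TSite d m) :
    ‖QprimeLin L m Rb l y‖ ≤ MA * (((L : ℝ) ^ d)⁻¹ * ∑ x ∈ B9Eq319QprimeTorus.blockOf L m y, ‖l x‖) := by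
  have hw : 0 ≤ ((L : ℝ) ^ d)⁻¹ := by positivity
  rw [QprimeLin_apply_eq_sum, mul_sum, mul_sum]
  refine (norm_sum_le _ _).trans (sum_le_sum fun x hx => ?_)
  rw [norm_smul, norm_inv, norm_pow, Real.norm_natCast]
  calc ((L : ℝ) ^ d)⁻¹ * ‖pathTr (stepTransport L m fun b => (Rb b).restrictScalars ℝ) (centre L m y :: contour L m x) (l x)‖
      ≤ ((L : ℝ) ^ d)⁻¹ * (MA * ‖l x‖) := mul_le_mul_of_nonneg_left (hA y x hx (l x)) hw
    _ = MA * (((L : ℝ) ^ d)⁻¹ * ‖l x‖) := by ring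

include hA in
/-- **THE SINGLE COMMUTATOR, POINTWISE**: `‖χ′(y)·(Q′λ)(y) − Q′(χλ)(y)‖ ≤ M_A·L^{−d}·Σ_{x∈B(y)} |χ′(y) − χ(x)|·‖λ(x)‖`.
[cite: Balaban1985BackgroundPropagators, (3.102) p.414, (3.19) p.393] -/
theorem norm_comm_QprimeLin_apply_le (χ' : TSite d m → ℝ) (χ : TSite d (fineP L m) → ℝ) (l : TSite d (fineP L m) → V) (y : TSite d m) :
    ‖(χ' y : ℂ) • QprimeLin L m Rb l y - QprimeLin L m Rb (fun x => (χ x : ℂ) • l x) y‖ ≤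
      MA * (((L : ℝ) ^ d)⁻¹ * ∑ x ∈ B9Eq319QprimeTorus.blockOf L m y, |χ' y - χ x| * ‖l x‖) := by
  have hw : 0 ≤ ((L : ℝ) ^ d)⁻¹ := by positivity
  rw [comm_QprimeLin_apply, mul_sum, mul_sum]
  refine (norm_sum_le _ _).trans (sum_le_sum fun x hx => ?_)
  rw [norm_smul, norm_inv, norm_pow, Real.norm_natCast, norm_smul, Complex.norm_real, Real.norm_eq_abs]
  have h2 := hA y x hx (l x)
  calc ((L : ℝ) ^ d)⁻¹ * (|χ' y - χ x| * ‖pathTr (stepTransport L m fun b => (Rb b).restrictScalars ℝ) (centre L m y :: contour L m x) (l x)‖)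
      ≤ ((L : ℝ) ^ d)⁻¹ * (|χ' y - χ x| * (MA * ‖l x‖)) :=
        mul_le_mul_of_nonneg_left (mul_le_mul_of_nonneg_left h2 (abs_nonneg _)) hw
    _ = MA * (((L : ℝ) ^ d)⁻¹ * (|χ' y - χ x| * ‖l x‖)) := by ring

include hA in
/-- **THE FIRST-ORDER SQUARE, POINTWISE — CAUCHY–SCHWARZ ON THE BLOCK** (kernel 7's letter `a`, here for the scalar `Q′`): with the block-oscillation letter `Σ_{j∈s} (χ′_j(y) − χ_j(x))² ≤ Θ` for
`x ∈ B(y)` (`|B(y)| = L^d`): `Σ_j ‖χ′_j(y)·(Q′λ)(y) − Q′(χ_jλ)(y)‖² ≤ M_A²·Θ·L^{−d}·Σ_{x∈B(y)} ‖λ(x)‖²` — the family is priced by `Θ` alone.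
[folklore] [cite: Balaban1985BackgroundPropagators, (3.102) p.414, p.408 «Σ h²_□ = 1», (3.19) p.393] -/
theorem sum_norm_sq_comm_QprimeLin_apply_le {J : Type*} (s : Finset J) {χ' : J → TSite d m → ℝ} {χ : J → TSite d (fineP L m) → ℝ} {Θ : ℝ}
    (hΘ : ∀ (y : TSite d m), ∀ x ∈ B9Eq319QprimeTorus.blockOf L m y, ∑ j ∈ s, (χ' j y - χ j x) ^ 2 ≤ Θ)
    (l : TSite d (fineP L m) → V) (y : TSite d m) :
    ∑ j ∈ s, ‖(χ' j y : ℂ) • QprimeLin L m Rb l y - QprimeLin L m Rb (fun x => (χ j x : ℂ) • l x) y‖ ^ 2 ≤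
      MA ^ 2 * Θ * (((L : ℝ) ^ d)⁻¹ * ∑ x ∈ B9Eq319QprimeTorus.blockOf L m y, ‖l x‖ ^ 2) := by
  set B := B9Eq319QprimeTorus.blockOf L m y with hB
  set w : ℝ := ((L : ℝ) ^ d)⁻¹ with hw
  have hL : (0 : ℝ) < (L : ℝ) ^ d := by
    have : (0 : ℝ) < L := by exact_mod_cast Nat.pos_of_ne_zero (NeZero.ne L)
    positivity
  have hw0 : 0 ≤ w := by positivity
  have hMA : ∀ x ∈ B, 0 ≤ MA * ‖l x‖ := fun x hx => (norm_nonneg _).trans (hA y x hx (l x))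
  -- each term: Cauchy–Schwarz on the block
  have hj : ∀ j ∈ s, ‖(χ' j y : ℂ) • QprimeLin L m Rb l y - QprimeLin L m Rb (fun x => (χ j x : ℂ) • l x) y‖ ^ 2 ≤
      MA ^ 2 * ((w * ∑ x ∈ B, (χ' j y - χ j x) ^ 2) * (w * ∑ x ∈ B, ‖l x‖ ^ 2)) := by
    intro j _
    have h1 := norm_comm_QprimeLin_apply_le L m hA (χ' j) (χ j) l y
    have h0 : 0 ≤ MA * (w * ∑ x ∈ B, |χ' j y - χ j x| * ‖l x‖) := (norm_nonneg _).trans h1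
    have hcs := sum_mul_sq_le_sq_mul_sq B (fun x => |χ' j y - χ j x|) (fun x => ‖l x‖)
    simp only [sq_abs] at hcs
    calc ‖(χ' j y : ℂ) • QprimeLin L m Rb l y - QprimeLin L m Rb (fun x => (χ j x : ℂ) • l x) y‖ ^ 2
        ≤ (MA * (w * ∑ x ∈ B, |χ' j y - χ j x| * ‖l x‖)) ^ 2 := pow_le_pow_left₀ (norm_nonneg _) h1 2
      _ = MA ^ 2 * (w ^ 2 * (∑ x ∈ B, |χ' j y - χ j x| * ‖l x‖) ^ 2) := by ring
      _ ≤ MA ^ 2 * (w ^ 2 * ((∑ x ∈ B, (χ' j y - χ j x) ^ 2) * ∑ x ∈ B, ‖l x‖ ^ 2)) :=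
          mul_le_mul_of_nonneg_left (mul_le_mul_of_nonneg_left hcs (sq_nonneg _)) (sq_nonneg _)
      _ = MA ^ 2 * ((w * ∑ x ∈ B, (χ' j y - χ j x) ^ 2) * (w * ∑ x ∈ B, ‖l x‖ ^ 2)) := by ring
  -- the oscillation letter summed over the block: `w·Σ_{x∈B}Σ_j (…)² ≤ w·|B|·Θ = Θ`
  have hosc : ∑ j ∈ s, (w * ∑ x ∈ B, (χ' j y - χ j x) ^ 2) ≤ Θ := by
    rw [← mul_sum, sum_comm]
    calc w * ∑ x ∈ B, ∑ j ∈ s, (χ' j y - χ j x) ^ 2 ≤ w * ∑ x ∈ B, Θ := mul_le_mul_of_nonneg_left (sum_le_sum fun x hx => hΘ y x hx) hw0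
      _ = Θ := by rw [sum_const, hB, card_blockOf, nsmul_eq_mul, Nat.cast_pow, hw]; field_simp
  have hl0 : 0 ≤ w * ∑ x ∈ B, ‖l x‖ ^ 2 := mul_nonneg hw0 (sum_nonneg fun _ _ => sq_nonneg _)
  calc ∑ j ∈ s, ‖(χ' j y : ℂ) • QprimeLin L m Rb l y - QprimeLin L m Rb (fun x => (χ j x : ℂ) • l x) y‖ ^ 2
      ≤ ∑ j ∈ s, MA ^ 2 * ((w * ∑ x ∈ B, (χ' j y - χ j x) ^ 2) * (w * ∑ x ∈ B, ‖l x‖ ^ 2)) := sum_le_sum hj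
    _ = MA ^ 2 * (∑ j ∈ s, (w * ∑ x ∈ B, (χ' j y - χ j x) ^ 2)) * (w * ∑ x ∈ B, ‖l x‖ ^ 2) := by
        rw [← mul_sum, ← sum_mul, mul_assoc]
    _ ≤ MA ^ 2 * Θ * (w * ∑ x ∈ B, ‖l x‖ ^ 2) :=
        mul_le_mul_of_nonneg_right (mul_le_mul_of_nonneg_left hosc (sq_nonneg _)) hl0

include hA in
/-- **THE DOUBLE-COMMUTATOR LETTER, POINTWISE** (kernel 7's `k`, here for the scalar `Q′`): with `Σ_{j∈s} (χ′_j(y) − χ_j(x))² ≤ Θ` on `x ∈ B(y)`: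
`‖Σ_j [χ′_j(y)·(ad_jQ′)λ(y) − (ad_jQ′)(χ_jλ)(y)]‖ ≤ M_A·Θ·L^{−d}·Σ_{x∈B(y)} ‖λ(x)‖`. [folklore]
[cite: Balaban1985BackgroundPropagators, (3.102) p.414 «O(M⁻²)», (3.19) p.393] -/
theorem norm_sum_comm_comm_QprimeLin_apply_le {J : Type*} (s : Finset J) {χ' : J → TSite d m → ℝ} {χ : J → TSite d (fineP L m) → ℝ} {Θ : ℝ}
    (hΘ : ∀ (y : TSite d m), ∀ x ∈ B9Eq319QprimeTorus.blockOf L m y, ∑ j ∈ s, (χ' j y - χ j x) ^ 2 ≤ Θ)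
    (l : TSite d (fineP L m) → V) (y : TSite d m) :
    ‖∑ j ∈ s, ((χ' j y : ℂ) • ((χ' j y : ℂ) • QprimeLin L m Rb l y - QprimeLin L m Rb (fun x => (χ j x : ℂ) • l x) y) -
        ((χ' j y : ℂ) • QprimeLin L m Rb (fun x => (χ j x : ℂ) • l x) y - QprimeLin L m Rb (fun x => (χ j x : ℂ) • ((χ j x : ℂ) • l x)) y))‖ ≤
      MA * Θ * (((L : ℝ) ^ d)⁻¹ * ∑ x ∈ B9Eq319QprimeTorus.blockOf L m y, ‖l x‖) := by
  have hw : 0 ≤ ((L : ℝ) ^ d)⁻¹ := by positivity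
  rw [sum_comm_comm_QprimeLin_apply, mul_sum, mul_sum]
  refine (norm_sum_le _ _).trans (sum_le_sum fun x hx => ?_)
  have hsq : 0 ≤ ∑ j ∈ s, (χ' j y - χ j x) ^ 2 := sum_nonneg fun _ _ => sq_nonneg _
  rw [norm_smul, norm_inv, norm_pow, Real.norm_natCast, norm_smul, Complex.norm_real, Real.norm_eq_abs, abs_of_nonneg hsq]
  have h2 := hA y x hx (l x)
  have hMA : 0 ≤ MA * ‖l x‖ := (norm_nonneg _).trans h2
  calc ((L : ℝ) ^ d)⁻¹ * ((∑ j ∈ s, (χ' j y - χ j x) ^ 2) *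
          ‖pathTr (stepTransport L m fun b => (Rb b).restrictScalars ℝ) (centre L m y :: contour L m x) (l x)‖)
      ≤ ((L : ℝ) ^ d)⁻¹ * (Θ * (MA * ‖l x‖)) :=
        mul_le_mul_of_nonneg_left (mul_le_mul (hΘ y x hx) h2 (norm_nonneg _) (hsq.trans (hΘ y x hx))) hw
    _ = MA * Θ * (((L : ℝ) ^ d)⁻¹ * ‖l x‖) := by ring

/-! ## §3 `ℓ²` sizes over the coarse torus: Jensen on each block, the blocks partition the fine torus -/

include hA in
/-- **THE SIZE OF `Q′` IN `ℓ²`**: `Σ_y ‖(Q′λ)(y)‖² ≤ M_A²·L^{−d}·Σ_x ‖λ(x)‖²` — VOLUME-FREE, no `η`, the background only through `M_A`.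
[cite: Balaban1985BackgroundPropagators, (3.19) p.393, (3.11) p.392] -/
theorem sum_norm_sq_QprimeLin_le (l : TSite d (fineP L m) → V) :
    ∑ y, ‖QprimeLin L m Rb l y‖ ^ 2 ≤ MA ^ 2 * (((L : ℝ) ^ d)⁻¹ * ∑ x, ‖l x‖ ^ 2) := by
  calc ∑ y, ‖QprimeLin L m Rb l y‖ ^ 2
      ≤ ∑ y, (MA * (((L : ℝ) ^ d)⁻¹ * ∑ x ∈ B9Eq319QprimeTorus.blockOf L m y, ‖l x‖)) ^ 2 :=
        sum_le_sum fun y _ => pow_le_pow_left₀ (norm_nonneg _) (norm_QprimeLin_apply_le L m hA l y) 2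
    _ ≤ ∑ y, MA ^ 2 * (((L : ℝ) ^ d)⁻¹ * ∑ x ∈ B9Eq319QprimeTorus.blockOf L m y, ‖l x‖ ^ 2) :=
        sum_le_sum fun y _ => by
          rw [mul_pow]; exact mul_le_mul_of_nonneg_left (blockMean_norm_sq_le L m l y) (sq_nonneg _)
    _ = MA ^ 2 * (((L : ℝ) ^ d)⁻¹ * ∑ x, ‖l x‖ ^ 2) := by
        rw [← mul_sum, ← mul_sum, sum_blockOf_sum]

include hA in
/-- **THE FIRST-ORDER SQUARE IN `ℓ²`**: with `Σ_{j∈s} (χ′_j(y) − χ_j(x))² ≤ Θ` on `x ∈ B(y)`: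
`Σ_j Σ_y ‖χ′_j(y)·(Q′λ)(y) − Q′(χ_jλ)(y)‖² ≤ M_A²·Θ·L^{−d}·Σ_x ‖λ(x)‖²` — VOLUME-FREE, family-count-free. [folklore]
[cite: Balaban1985BackgroundPropagators, (3.102) p.414, p.408, (3.11) p.392] -/
theorem sum_sum_norm_sq_comm_QprimeLin_le {J : Type*} (s : Finset J) {χ' : J → TSite d m → ℝ} {χ : J → TSite d (fineP L m) → ℝ} {Θ : ℝ}
    (hΘ : ∀ (y : TSite d m), ∀ x ∈ B9Eq319QprimeTorus.blockOf L m y, ∑ j ∈ s, (χ' j y - χ j x) ^ 2 ≤ Θ)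
    (l : TSite d (fineP L m) → V) :
    ∑ j ∈ s, ∑ y, ‖(χ' j y : ℂ) • QprimeLin L m Rb l y - QprimeLin L m Rb (fun x => (χ j x : ℂ) • l x) y‖ ^ 2 ≤
      MA ^ 2 * Θ * (((L : ℝ) ^ d)⁻¹ * ∑ x, ‖l x‖ ^ 2) := by
  rw [sum_comm]
  calc ∑ y, ∑ j ∈ s, ‖(χ' j y : ℂ) • QprimeLin L m Rb l y - QprimeLin L m Rb (fun x => (χ j x : ℂ) • l x) y‖ ^ 2
      ≤ ∑ y, MA ^ 2 * Θ * (((L : ℝ) ^ d)⁻¹ * ∑ x ∈ B9Eq319QprimeTorus.blockOf L m y, ‖l x‖ ^ 2) :=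
        sum_le_sum fun y _ => sum_norm_sq_comm_QprimeLin_apply_le L m hA s hΘ l y
    _ = MA ^ 2 * Θ * (((L : ℝ) ^ d)⁻¹ * ∑ x, ‖l x‖ ^ 2) := by
        rw [← mul_sum, ← mul_sum, sum_blockOf_sum]

include hA in
/-- **THE DOUBLE COMMUTATOR IN `ℓ²`**: with `Σ_{j∈s} (χ′_j(y) − χ_j(x))² ≤ Θ` on `x ∈ B(y)`:
`Σ_y ‖Σ_j [χ′_j(y)·(ad_jQ′)λ(y) − (ad_jQ′)(χ_jλ)(y)]‖² ≤ (M_AΘ)²·L^{−d}·Σ_x ‖λ(x)‖²`. [folklore]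
[cite: Balaban1985BackgroundPropagators, (3.102) p.414 «O(M⁻²)», (3.11) p.392] -/
theorem sum_norm_sq_sum_comm_comm_QprimeLin_le {J : Type*} (s : Finset J) {χ' : J → TSite d m → ℝ} {χ : J → TSite d (fineP L m) → ℝ} {Θ : ℝ}
    (hΘ : ∀ (y : TSite d m), ∀ x ∈ B9Eq319QprimeTorus.blockOf L m y, ∑ j ∈ s, (χ' j y - χ j x) ^ 2 ≤ Θ)
    (l : TSite d (fineP L m) → V) :
    ∑ y, ‖∑ j ∈ s, ((χ' j y : ℂ) • ((χ' j y : ℂ) • QprimeLin L m Rb l y - QprimeLin L m Rb (fun x => (χ j x : ℂ) • l x) y) -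
        ((χ' j y : ℂ) • QprimeLin L m Rb (fun x => (χ j x : ℂ) • l x) y - QprimeLin L m Rb (fun x => (χ j x : ℂ) • ((χ j x : ℂ) • l x)) y))‖ ^ 2 ≤
      (MA * Θ) ^ 2 * (((L : ℝ) ^ d)⁻¹ * ∑ x, ‖l x‖ ^ 2) := by
  calc _ ≤ ∑ y, (MA * Θ * (((L : ℝ) ^ d)⁻¹ * ∑ x ∈ B9Eq319QprimeTorus.blockOf L m y, ‖l x‖)) ^ 2 :=
        sum_le_sum fun y _ => pow_le_pow_left₀ (norm_nonneg _) (norm_sum_comm_comm_QprimeLin_apply_le L m hA s hΘ l y) 2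
    _ ≤ ∑ y, (MA * Θ) ^ 2 * (((L : ℝ) ^ d)⁻¹ * ∑ x ∈ B9Eq319QprimeTorus.blockOf L m y, ‖l x‖ ^ 2) :=
        sum_le_sum fun y _ => by
          rw [mul_pow]; exact mul_le_mul_of_nonneg_left (blockMean_norm_sq_le L m l y) (sq_nonneg _)
    _ = (MA * Θ) ^ 2 * (((L : ℝ) ^ d)⁻¹ * ∑ x, ‖l x‖ ^ 2) := by
        rw [← mul_sum, ← mul_sum, sum_blockOf_sum]

end Function

end Literature.MathematicalPhysics.QuantumFieldTheory.Balaban1983to89.B9Eq3102QprimeCommutatorLetters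

end
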